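import Mathlib

/-!
# Manin–Gamma cell (pub-manin-gamma0): the rank step of T1 Prop. 5.1, Step 1 (seat p1, gen 2)

In `proofs/T1_lead.md` Prop. 5.1, Step 1, the two square classes `d₁(R), d₂(R) ∈ ℚ^×/ℚ^{×2}` are POSITIVE,
NON-TRIVIAL and DISTINCT (4.6(iii),(iv)); representing positive square classes by squarefree positive integers,
one needs two primes `ℓ ≠ ℓ′` whose «valuation vectors» `w_ℓ = ([ℓ ∣ d₁], [ℓ ∣ d₂]) ∈ 𝔽₂²` are linearly
independent, i.e. non-zero and distinct. This file machine-checks that elementary step.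

* `ManinGamma.SquarefreeRank.exists_prime_dvd_xor` — distinct squarefree numbers are separated by a prime.
* `ManinGamma.SquarefreeRank.exists_two_primes_indep` — the Step-1 statement.
Only Mathlib is imported; no `sorry`.
-/

namespace ManinGamma.SquarefreeRank

/-- Two distinct squarefree natural numbers are separated by some prime (one divides exactly one of them). -/
theorem exists_prime_dvd_xor {d₁ d₂ : ℕ} (h₁ : Squarefree d₁) (h₂ : Squarefree d₂) (hne : d₁ ≠ d₂) :
    ∃ q : ℕ, q.Prime ∧ ¬ (q ∣ d₁ ↔ q ∣ d₂) := by
  by_contra hcon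
  push Not at hcon
  exact hne ((Nat.Squarefree.ext_iff h₁ h₂).mpr hcon)

/-- **Prop. 5.1, Step 1 (rank step).** For squarefree `d₁ ≠ d₂`, both `≠ 1`, there are primes `ℓ, ℓ′` whose vectors
`w_ℓ = ([ℓ ∣ d₁], [ℓ ∣ d₂])`, `w_ℓ′` are both non-zero and distinct — i.e. linearly independent in `𝔽₂²`. -/
theorem exists_two_primes_indep {d₁ d₂ : ℕ} (h₁ : Squarefree d₁) (h₂ : Squarefree d₂)
    (hd₁ : d₁ ≠ 1) (hd₂ : d₂ ≠ 1) (hne : d₁ ≠ d₂) :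
    ∃ ℓ ℓ' : ℕ, ℓ.Prime ∧ ℓ'.Prime ∧ (ℓ ∣ d₁ ∨ ℓ ∣ d₂) ∧ (ℓ' ∣ d₁ ∨ ℓ' ∣ d₂) ∧
      ¬ ((ℓ ∣ d₁ ↔ ℓ' ∣ d₁) ∧ (ℓ ∣ d₂ ↔ ℓ' ∣ d₂)) := by
  obtain ⟨p, hp, hpd₁⟩ := Nat.exists_prime_and_dvd hd₁
  by_cases hpd₂ : p ∣ d₂
  · -- w_p = (1,1); a separating prime q has w_q ∈ {(1,0),(0,1)}
    obtain ⟨q, hq, hqx⟩ := exists_prime_dvd_xor h₁ h₂ hne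
    refine ⟨p, q, hp, hq, Or.inl hpd₁, ?_, ?_⟩
    · by_cases hq₁ : q ∣ d₁
      · exact Or.inl hq₁
      · right
        by_contra hq₂
        exact hqx ⟨fun h => absurd h hq₁, fun h => absurd h hq₂⟩
    · rintro ⟨e₁, e₂⟩
      exact hqx ⟨fun h => e₂.mp hpd₂, fun _ => e₁.mp hpd₁⟩
  · -- w_p = (1,0); any prime q ∣ d₂ has w_q = (?,1) ≠ w_p
    obtain ⟨q, hq, hqd₂⟩ := Nat.exists_prime_and_dvd hd₂
    refine ⟨p, q, hp, hq, Or.inl hpd₁, Or.inr hqd₂, ?_⟩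
    rintro ⟨_, e₂⟩
    exact hpd₂ (e₂.mpr hqd₂)

end ManinGamma.SquarefreeRank
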